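import Summits.BirchSwinnertonDyer.BirchSwinnertonDyer.Theorems.Rank2Observatory2DescKillSig2CDriver
import Summits.BirchSwinnertonDyer.BirchSwinnertonDyer.Theorems.Rank2Observatory2DescKillSig2XWalk
import Summits.BirchSwinnertonDyer.BirchSwinnertonDyer.Theorems.Rank2Observatory2DescKillValid
import HarnessLib

/-!
# KERNEL-2DESC — the 2-adic signature kill at a CUBIC place, PART 3b of 3: the checker `sig2cCheck`
and its soundness `killValidAt_of_sig2cCheck` (cert-1 g40)

SETTING.  `p = 2` and the cubic `g(x) = x³ + a x² + b x + c` of the kill term is irreducible over `ℚ₂`; its root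
`θ` generates the ring `O = ℤ₂[t]/(t³ − m₁ t − m₀)` with `(m₁, m₀) = (0, 2)` (RAMIFIED, `t = π`, `π³ = 2`) or
`(−1, −1)` (UNRAMIFIED, `t = ζ`, `ζ³ = −ζ − 1`), selected by `ram`.  The certificate names `N` and a truncation
`ρ ∈ ℤ³` of the coordinates of `θ` (so `g(ρ) ≡ 0 (mod 2^N)` coordinatewise, checked), and a walk depth `jmax`.

THE ARGUMENT (all of it kernel-checked below; rows use kernel-only `decide`).  Let `(r, n)` be a primitive zero of `killQ`.
With `R = ρ-evaluation of r`, `Z` of `z`, `T` of `θ_T = t₁θ + t₂θ²` and `w₀ = zsq(r).1`, PART 1's `root_rel₃`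
gives `Z·R² ≡ (w₀, 0, 0) − n²·T (mod 2^N)`, whence for `Q = Z·R`:  `Q² ≡ w₀·Z − n²·(Z·T) (mod 2^N)` (`E`).
* `n` odd: multiplying by the square of an inverse of `n` gives `S² ≡ X(c₀) = c₀·Z − Z·T` and the certified
  binary walk over `c₀ mod 2^j` (leaf = the table test `nonsqT` of PART 2 on `X(c)`) refutes it.
* `n` even: primitivity and `even_of_cev_dvd` (PART 1) give `2^(δ+1) ∤ R` (`2^δ ∥ det3 ρ`), so the CONTENT BOUND
  of PART 3a caps `v₂` of every common divisor of `(w₀, n²)` by `B`; then either `w₀ = 2^k u` with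
  `k < 2·v₂(n)` — one of the finitely many PATTERN classes `2^k(u·Z − 2^σ·Z·T)`, `u` odd mod 16,
  `σ ∈ {1, 2, 3, ≥ 4}`, each certified non-square — or `v₂(w₀) ≥ 2τ = 2·v₂(n) ≤ B`, where dividing by
  `(2^τ·n₁)²` and stripping `τ` factors `4` (`strip_pow`) lands in the same walk at precision `N − 2τ`.
`w₀ = n = 0` contradicts the content bound directly (`B < N`).

MAIN RESULTS: `sig2cCheck` (the `Bool` checker; per-curve rows discharge it by `decide +kernel`) and
`killValidAt_of_sig2cCheck : sig2cCheck ram a b c z t₁ t₂ N ρ jmax = true → KillValidAt 2 a b c z t₁ t₂`.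
An independent Python engine (exact 2-adic class test) and a literal mirror of this checker agree with the
KERNEL-2DESC census on all 966 + 107 cubic-place classes probed (cert-1 g40, `generics/sig2c/`).

HONEST FRAMING: per-curve certified theorems and census instruments; no claim on BSD in rank ≥ 2.
[cite: CremonaAlgorithms1997, §3.6] [cite: Cassels1991LecturesEllipticCurves, §15] [cite: Cohen1993, §4.8.2]
-/

set_option linter.dupNamespace false

namespace Summit.BirchSwinnertonDyer.BirchSwinnertonDyer.Rank2Observatory.TwoDescKill

/-! ### The checker -/

/-- The certified content exponent of `Z`: the least of the three 2-adic split exponents. [folklore] -/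
def c3min (N : ℕ) (Z : ℤ × ℤ × ℤ) : ℕ :=
  min (min (splitPow 2 N Z.1).1 (splitPow 2 N Z.2.1).1) (splitPow 2 N Z.2.2).1

/-- **The Sig2C checker.**  `ram` selects the order (`π³ = 2` / `ζ³ = −ζ − 1`); `ρ` is the certified truncation
of the root coordinates (`g(ρ) ≡ 0 (mod 2^N)`), `jmax` the walk depth.  Conditions, in order: `g(ρ) ≡ 0`;
`det3 ρ = 2^δ·d`, `d` odd; `Z = 2^cZ·Z̄` with `Z̄ ≢ 0 (mod 2)`; `B + 1 ≤ N` for the content bound `B`;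
the pattern block; the certified walk (leaf precision `min (N − 2⌊B/2⌋) (j + cZ)`, guard `j + 2 < N`).
[cite: CremonaAlgorithms1997, §3.6] -/
def sig2cCheck (ram : Bool) (a b c : ℤ) (z : ℤ × ℤ × ℤ) (t₁ t₂ : ℤ) (N : ℕ) (ρ : ℤ × ℤ × ℤ) (jmax : ℕ) : Bool :=
  let G := cgev (tm₁ ram) (tm₀ ram) a b c ρ
  let dd := splitPow 2 N (det3 (tm₁ ram) (tm₀ ram) ρ)
  let Z := cmod N (cev (tm₁ ram) (tm₀ ram) ρ z)
  let T := cmod N (cev (tm₁ ram) (tm₀ ram) ρ (0, t₁, t₂))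
  let cZ := c3min N Z
  let B := cB ram cZ dd.1
  decide (G.1 % (2 : ℤ) ^ N = 0) && decide (G.2.1 % (2 : ℤ) ^ N = 0) && decide (G.2.2 % (2 : ℤ) ^ N = 0) &&
  decide (dd.2 % 2 ≠ 0) &&
  decide (Z.1 % (2 : ℤ) ^ cZ = 0) && decide (Z.2.1 % (2 : ℤ) ^ cZ = 0) && decide (Z.2.2 % (2 : ℤ) ^ cZ = 0) &&
  (czero2 (Z.1 / (2 : ℤ) ^ cZ, Z.2.1 / (2 : ℤ) ^ cZ, Z.2.2 / (2 : ℤ) ^ cZ) == false) &&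
  decide (B + 1 ≤ N) &&
  sig2cPat ram N cZ B Z (cmul (tm₁ ram) (tm₀ ram) Z T) &&
  walk2x (sig2cLeaf ram N cZ (B / 2) Z (cmul (tm₁ ram) (tm₀ ram) Z T)) 0 N jmax 0 0

/-! ### The integral side: scaling by an inverse, stripping, and the walk -/

/-- **Walk contradiction.**  `Q² ≡ 4^τ·w₁·Z − 4^τ·n₁²·(Z·T) (mod 2^N)` with `n₁` odd, `τ ≤ τmax`, `2τ ≤ N`
and a certified walk is absurd: scale by `ι²` (`ι·n₁ ≡ 1`), strip `τ` fours, land on `X(ι²·w₁)`. [folklore] -/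
theorem walk_contra (ram : Bool) {N cZ τmax jmax τ : ℕ} {Z ZT Zb ZTb Q : ℤ × ℤ × ℤ} {n₁ w₁ : ℤ}
    (hZ : Z = csc ((2 : ℤ) ^ cZ) Zb) (hZT : ZT = csc ((2 : ℤ) ^ cZ) ZTb)
    (hwalk : walk2x (sig2cLeaf ram N cZ τmax Z ZT) 0 N jmax 0 0 = true) (hτ : τ ≤ τmax) (h2τ : 2 * τ ≤ N)
    (hn₁ : ¬ (2 : ℤ) ∣ n₁)
    (hE : CME ((2 : ℤ) ^ N) (cmul (tm₁ ram) (tm₀ ram) Q Q)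
      (cPat Z ZT ((2 : ℤ) ^ (2 * τ) * w₁) (-((2 : ℤ) ^ (2 * τ) * n₁ ^ 2)))) : False := by
  obtain ⟨ι, hι⟩ := exists_inv_two_pow hn₁ N
  set S := csc ι Q with hS
  -- `S² ≡ ι²·(…) ≡ 4^τ · X(ι² w₁)`
  have h1 : CME ((2 : ℤ) ^ N) (cmul (tm₁ ram) (tm₀ ram) S S)
      (cPat Z ZT (ι * ι * ((2 : ℤ) ^ (2 * τ) * w₁)) (ι * ι * -((2 : ℤ) ^ (2 * τ) * n₁ ^ 2))) := by
    rw [hS, cmul_csc_csc, ← csc_cPat]; exact hE.csc _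
  have hsq : (2 : ℤ) ^ N ∣ 1 - (ι * n₁) ^ 2 := by
    have := (hι.pow 2).dvd; simpa using this
  have h2 : CME ((2 : ℤ) ^ N) (cPat Z ZT (ι * ι * ((2 : ℤ) ^ (2 * τ) * w₁)) (ι * ι * -((2 : ℤ) ^ (2 * τ) * n₁ ^ 2)))
      (csc ((2 : ℤ) ^ (2 * τ)) (cX Z ZT (ι ^ 2 * w₁))) := by
    rw [cX, csc_cPat]
    refine (cPat_congr (m := N) hZ hZT ?_ ?_).of_dvd (pow_dvd_pow 2 (Nat.le_add_right N cZ))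
    · exact ⟨0, by ring⟩
    · have e : ι * ι * -((2 : ℤ) ^ (2 * τ) * n₁ ^ 2) - (2 : ℤ) ^ (2 * τ) * (-1) =
          (2 : ℤ) ^ (2 * τ) * (1 - (ι * n₁) ^ 2) := by ring
      rw [e]; exact hsq.mul_left _
  obtain ⟨S', hS'⟩ := strip_pow ram (cX Z ZT (ι ^ 2 * w₁)) τ N S h2τ (h1.trans h2)
  exact walk2x_sound (B := 0) (N := N)
    (P := fun y => ∃ τ' : ℕ, τ' ≤ τmax ∧ ∃ S'' : ℤ × ℤ × ℤ,
      CME ((2 : ℤ) ^ (N - 2 * τ')) (cmul (tm₁ ram) (tm₀ ram) S'' S'') (cX Z ZT y))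
    (fun c j hl _ y hy hP => leaf_sound2c ram hZ hZT c j hl y hy hP) jmax 0 0 hwalk (ι ^ 2 * w₁) (by simp)
    ⟨τ, hτ, S', hS'⟩

/-! ### Soundness -/

/-- **Sig2C soundness**: a kill term certified by `sig2cCheck` at a cubic 2-adic place has no primitive zero —
`KillValidAt 2`.  [cite: CremonaAlgorithms1997, §3.6] [cite: Cassels1991LecturesEllipticCurves, §15] -/
theorem killValidAt_of_sig2cCheck {ram : Bool} {a b c : ℤ} {z : ℤ × ℤ × ℤ} {t₁ t₂ : ℤ} {N : ℕ} {ρ : ℤ × ℤ × ℤ}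
    {jmax : ℕ} (h : sig2cCheck ram a b c z t₁ t₂ N ρ jmax = true) : KillValidAt 2 a b c z t₁ t₂ := by
  intro v hprim h0
  obtain ⟨r₀, r₁, r₂, n⟩ := v
  simp only [sig2cCheck, Bool.and_eq_true, decide_eq_true_eq, beq_iff_eq] at h
  obtain ⟨⟨⟨⟨⟨⟨⟨⟨⟨⟨hG₁, hG₂⟩, hG₃⟩, hd⟩, hZ₁⟩, hZ₂⟩, hZ₃⟩, hZb⟩, hBN⟩, hpat⟩, hwalk⟩ := h
  -- names for the certified data
  have hZc := CME_cmod N (cev (tm₁ ram) (tm₀ ram) ρ z)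
  have hTc := CME_cmod N (cev (tm₁ ram) (tm₀ ram) ρ (0, t₁, t₂))
  generalize hZdef : cmod N (cev (tm₁ ram) (tm₀ ram) ρ z) = Z at hZ₁ hZ₂ hZ₃ hZb hBN hpat hwalk hZc
  generalize hTdef : cmod N (cev (tm₁ ram) (tm₀ ram) ρ (0, t₁, t₂)) = T at hpat hwalk hTc
  have hΔ := splitPow_spec 2 N (det3 (tm₁ ram) (tm₀ ram) ρ)
  generalize hdd : splitPow 2 N (det3 (tm₁ ram) (tm₀ ram) ρ) = dd at hd hBN hpat hwalk hΔ
  obtain ⟨δ, d⟩ := dd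
  generalize hcZ : c3min N Z = cZ at hZ₁ hZ₂ hZ₃ hZb hBN hpat hwalk
  simp only [Nat.cast_ofNat] at hΔ
  simp only at hd hBN hpat hwalk
  set B := cB ram cZ δ with hB
  -- `Z = 2^cZ · Z̄`, `Z·T = 2^cZ · (Z̄·T)`
  set Zb : ℤ × ℤ × ℤ := (Z.1 / (2 : ℤ) ^ cZ, Z.2.1 / (2 : ℤ) ^ cZ, Z.2.2 / (2 : ℤ) ^ cZ) with hZbdef
  have hZe : Z = csc ((2 : ℤ) ^ cZ) Zb := by
    simp only [csc, hZbdef]; ext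
    · exact (Int.mul_ediv_cancel' (Int.dvd_of_emod_eq_zero hZ₁)).symm
    · exact (Int.mul_ediv_cancel' (Int.dvd_of_emod_eq_zero hZ₂)).symm
    · exact (Int.mul_ediv_cancel' (Int.dvd_of_emod_eq_zero hZ₃)).symm
  have hZTe : cmul (tm₁ ram) (tm₀ ram) Z T = csc ((2 : ℤ) ^ cZ) (cmul (tm₁ ram) (tm₀ ram) Zb T) := by
    rw [hZe, cmul_comm, cmul_csc, cmul_comm]
  have hdodd : ¬ (2 : ℤ) ∣ d := fun h2 => hd (Int.emod_eq_zero_of_dvd h2)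
  -- the kill relation `E : Q² ≡ w₀·Z − n²·(Z·T) (mod 2^N)`, `Q = Z·R`
  set R := cev (tm₁ ram) (tm₀ ram) ρ (r₀, r₁, r₂) with hR
  set w₀ := (zsq a b c z (r₀, r₁, r₂)).1 with hw₀
  obtain ⟨d₁, d₂, d₃⟩ := root_rel₃ (m₁ := tm₁ ram) (m₀ := tm₀ ram) (Int.dvd_of_emod_eq_zero hG₁)
    (Int.dvd_of_emod_eq_zero hG₂) (Int.dvd_of_emod_eq_zero hG₃) h0
  rw [zero_sub] at d₂ d₃
  have E0 : CME ((2 : ℤ) ^ N) (cmul (tm₁ ram) (tm₀ ram) Z (cmul (tm₁ ram) (tm₀ ram) R R))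
      (w₀ - n ^ 2 * T.1, -(n ^ 2 * T.2.1), -(n ^ 2 * T.2.2)) := by
    refine (hZc.cmul CME.rfl).trans ⟨?_, ?_, ?_⟩
    · exact (Int.modEq_iff_dvd.mpr d₁).symm.trans ((Int.ModEq.refl w₀).sub ((hTc.1.symm).mul_left _))
    · exact (Int.modEq_iff_dvd.mpr d₂).symm.trans ((hTc.2.1.symm).mul_left _).neg
    · exact (Int.modEq_iff_dvd.mpr d₃).symm.trans ((hTc.2.2.symm).mul_left _).neg
  have E : CME ((2 : ℤ) ^ N) (cmul (tm₁ ram) (tm₀ ram) (cmul (tm₁ ram) (tm₀ ram) Z R) (cmul (tm₁ ram) (tm₀ ram) Z R))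
      (cPat Z (cmul (tm₁ ram) (tm₀ ram) Z T) w₀ (-(n ^ 2))) := by
    have := (CME.rfl (A := Z)).cmul E0 (m₁ := tm₁ ram) (m₀ := tm₀ ram)
    rwa [← cmul_sq_ZR, cmul_lin'] at this
  by_cases hn : (2 : ℤ) ∣ n
  · -- `n` even: the content bound is available
    have hRn : ¬ ((2 : ℤ) ^ (δ + 1) ∣ R.1 ∧ (2 : ℤ) ^ (δ + 1) ∣ R.2.1 ∧ (2 : ℤ) ^ (δ + 1) ∣ R.2.2) := by
      intro hh
      obtain ⟨e₀, e₁, e₂⟩ := even_of_cev_dvd hΔ hdodd hh.1 hh.2.1 hh.2.2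
      exact hprim ⟨e₀, e₁, e₂, hn⟩
    have hcont := content_ZRR ram hZe hZb hRn
    have hBW : ∀ m : ℕ, (2 : ℤ) ^ m ∣ w₀ → (2 : ℤ) ^ m ∣ n ^ 2 → m ≤ B := by
      intro m hw hn2
      by_contra hm
      have p : (2 : ℤ) ^ (B + 1) ∣ (2 : ℤ) ^ m := pow_dvd_pow 2 (by omega)
      refine hcont (dvd_of_CME (E0.of_dvd (pow_dvd_pow 2 hBN)) ⟨?_, ?_, ?_⟩)
      · exact dvd_sub (p.trans hw) ((p.trans hn2).mul_right _)
      · exact dvd_neg.mpr ((p.trans hn2).mul_right _)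
      · exact dvd_neg.mpr ((p.trans hn2).mul_right _)
    by_cases hn0 : n = 0
    · subst hn0
      by_cases hw : w₀ = 0
      · have := hBW (B + 1) (by rw [hw]; exact dvd_zero _) (by simp)
        omega
      · obtain ⟨k, u, hk, hu⟩ := exists_two_pow_mul_odd w₀.natAbs w₀ hw le_rfl
        have hkB : k ≤ B := hBW k (by rw [hk]; exact dvd_mul_right _ _) (by simp)
        exact pat_contra ram hpat hkB hu (sh := 0) (zero_mem_patShifts k) hZe hZTe E (by rw [hk, sub_self]; exact dvd_zero _)
          (by simp)
    · obtain ⟨τ, n₁, hτ, hn₁⟩ := exists_two_pow_mul_odd n.natAbs n hn0 le_rfl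
      have hn2 : n ^ 2 = (2 : ℤ) ^ (2 * τ) * n₁ ^ 2 := by rw [hτ]; ring
      by_cases hw : w₀ = 0
      · -- integral side with `w₁ = 0`
        have hτB : 2 * τ ≤ B := hBW (2 * τ) (by rw [hw]; exact dvd_zero _) (by rw [hn2]; exact dvd_mul_right _ _)
        refine walk_contra ram (Q := cmul (tm₁ ram) (tm₀ ram) Z R) hZe hZTe hwalk (τ := τ) (by omega) (by omega) hn₁ (w₁ := 0) ?_
        rw [mul_zero, ← hw, ← hn2]; exact E
      · obtain ⟨k, u, hk, hu⟩ := exists_two_pow_mul_odd w₀.natAbs w₀ hw le_rfl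
        by_cases hkτ : 2 * τ ≤ k
        · -- integral side with `w₁ = 2^(k − 2τ)·u`
          have hτB : 2 * τ ≤ B :=
            hBW (2 * τ) (by rw [hk]; exact (pow_dvd_pow 2 hkτ).mul_right u) (by rw [hn2]; exact dvd_mul_right _ _)
          refine walk_contra ram (Q := cmul (tm₁ ram) (tm₀ ram) Z R) hZe hZTe hwalk (τ := τ) (by omega) (by omega) hn₁ (w₁ := (2 : ℤ) ^ (k - 2 * τ) * u) ?_
          have e : w₀ = (2 : ℤ) ^ (2 * τ) * ((2 : ℤ) ^ (k - 2 * τ) * u) := by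
            rw [hk, ← mul_assoc, ← pow_add, Nat.add_sub_cancel' hkτ]
          rw [← e, ← hn2]; exact E
        · -- pattern side: `σ = 2τ − k ≥ 1`
          have hkB : k ≤ B := hBW k (by rw [hk]; exact dvd_mul_right _ _)
            (by rw [hn2]; exact (pow_dvd_pow 2 (by omega : k ≤ 2 * τ)).mul_right _)
          obtain ⟨σ, hσ⟩ : ∃ σ : ℕ, 2 * τ = k + σ := ⟨2 * τ - k, by omega⟩
          by_cases hσ4 : 4 ≤ σ
          · refine pat_contra ram hpat hkB hu (sh := 0) (zero_mem_patShifts k) hZe hZTe E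
              (by rw [hk, sub_self]; exact dvd_zero _) ?_
            rw [hn2, hσ, mul_zero, add_zero]
            exact dvd_neg.mpr ((pow_dvd_pow 2 (by omega : k + 4 ≤ k + σ)).mul_right _)
          · obtain ⟨σ', hσ'⟩ : ∃ σ' : ℕ, σ = σ' + 1 := ⟨σ - 1, by omega⟩
            refine pat_contra ram hpat hkB hu (sh := (2 : ℤ) ^ σ) ?_ hZe hZTe E
              (by rw [hk, sub_self]; exact dvd_zero _) ?_
            · have : σ = 1 ∨ σ = 2 ∨ σ = 3 := by omega
              rcases this with rfl | rfl | rfl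
              · rw [patShifts, if_neg (by omega)]; simp
              · rw [patShifts, if_pos (by omega)]; simp
              · rw [patShifts, if_neg (by omega)]; simp
            · obtain ⟨j, hj⟩ := eight_dvd_sq_sub_one hn₁
              refine ⟨-((2 : ℤ) ^ σ' * j), ?_⟩
              rw [hn2, hσ, hσ']
              have e : n₁ ^ 2 = 8 * j + 1 := by linarith
              rw [e, pow_add, pow_add, pow_succ]; ring
  · -- `n` odd: integral side with `τ = 0`
    refine walk_contra ram (Q := cmul (tm₁ ram) (tm₀ ram) Z R) hZe hZTe hwalk (τ := 0) (Nat.zero_le _) (by omega) hn (w₁ := w₀) ?_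
    simpa using E

end Summit.BirchSwinnertonDyer.BirchSwinnertonDyer.Rank2Observatory.TwoDescKill
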